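import Literature.MathematicalPhysics.KineticTheory.HardSphereUniformGasShift
import Summits.AtomisticToContinuum.HydrodynamicLimit.Theorems.JParityClosureRateFloorPerParticleFreeStretch
import HarnessLib

/-!
# Rung ½ for the crux `EnergyCurrentTails` (stmt-AtomisticToContinuum-9235): preliminaries of
# stub D `stub_rhsShortTime` (seat c4, line `level-census-comparison`)

Two inputs of the short-window bound on the right-hand side of `ContactIntensityDomination` under
the hot-spot local Gibbs law `λ` (activity `a`, drift `0`, temperature `θhot x = 2 − ‖x‖`):

* `rhsShortTime_lintegral_sum_oneBody` — ONE-BODY VELOCITY AVERAGES: for a bounded continuous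
  `β ≥ 0`, `E_λ ∑ᵢ β(vᵢ) = (N+1) ∫_{𝕋³} (∫ β dN(0, θhot(x) id)) dx` (disintegration
  `lintegral_localGibbsMeasure`: the velocity fibre of particle `i` given the positions is
  `N(0, θhot(xᵢ) id)`; the one-particle position marginal of the homogeneous configurational Gibbs
  measure is uniform, `integral_mul_shiftInvariant`; continuity of `x ↦ ∫ β dN(0, θhot(x) id)` by
  dominated convergence through `N(0, θ) = (√θ ·)_* N(0, 1)`);
* `rhsShortTime_sum_flow_le` — PATHWISE COUNT (registered helper): on a good orbit, for `0 < τ ≤ h`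
  and `β ≤ 1`, `∑ᵢ β(vᵢ(τ)) ≤ ∑ᵢ β(vᵢ(0)) + 2 · #(collision times in (0, h])`: a particle taking part
  in no collision during `(0, τ]` keeps its initial velocity (per-particle free stretch
  `RateFloorPerParticleFreeStretch.stub_perParticleFreeStretch`), and each (binary) collision has
  exactly two participants (`IsHardSphereTrajectory.participates_iff`).
-/

noncomputable section

open MeasureTheory Set Filter ProbabilityTheory
open scoped ENNReal InnerProductSpace BigOperators Classical

namespace Summit.AtomisticToContinuum.HydrodynamicLimit.Theorems.EnergyCurrentTailsRungHalf

open Literature.MathematicalPhysics.KineticTheory Literature.Analysis.FluidPDE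

/-! ## The hot-spot temperature profile and the one-body Gaussian averages -/

/-- Points of the unit torus have sup-norm at most `1/2`. -/
private theorem norm_T3_le (x : T3) : ‖x‖ ≤ 1 / 2 := by
  refine (pi_norm_le_iff_of_nonneg (by norm_num)).2 fun i => ?_
  have h := AddCircle.norm_le_half_period (1 : ℝ) (x := x i) one_ne_zero
  rwa [abs_one] at h

/-- The hot-spot temperature `2 − ‖x‖` is positive. -/
private theorem thetaHot_pos (x : T3) : 0 < 2 - ‖x‖ := by
  linarith [norm_T3_le x]

/-- A bounded continuous one-body velocity observable is integrable under every `gaussMeasure`. -/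
private theorem integrable_gauss {β : V3 → ℝ} (hβc : Continuous β) (hβ0 : ∀ v, 0 ≤ β v)
    (hβ1 : ∀ v, β v ≤ 1) (u : V3) (θ : ℝ) : Integrable β (gaussMeasure u θ) := by
  refine (integrable_const (1 : ℝ)).mono' hβc.aestronglyMeasurable (ae_of_all _ fun v => ?_)
  rw [Real.norm_eq_abs, abs_le]
  exact ⟨by linarith [hβ0 v], hβ1 v⟩

/-- Continuity of the Gaussian average `x ↦ ∫ β dN(0, (2 − ‖x‖) id)` of a bounded continuous
observable (dominated convergence through `N(0, θ) = (√θ ·)_* N(0, 1)`). -/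
private theorem continuous_gaussAverage {β : V3 → ℝ} (hβc : Continuous β) (hβ0 : ∀ v, 0 ≤ β v)
    (hβ1 : ∀ v, β v ≤ 1) :
    Continuous fun x : T3 => ∫ v, β v ∂gaussMeasure (0 : V3) (2 - ‖x‖) := by
  have h : ∀ x : T3, ∫ v, β v ∂gaussMeasure (0 : V3) (2 - ‖x‖) =
      ∫ w, β ((0 : V3) + Real.sqrt (2 - ‖x‖) • w) ∂stdGaussian V3 := fun x =>
    integral_gaussMeasure (0 : V3) (thetaHot_pos x) β
  simp_rw [h]
  refine continuous_of_dominated (bound := fun _ => (1 : ℝ)) (fun x => ?_) (fun x => ?_)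
    (integrable_const 1) ?_
  · exact (hβc.comp (continuous_const.add
      (continuous_id.const_smul (Real.sqrt (2 - ‖x‖))))).aestronglyMeasurable
  · refine ae_of_all _ fun w => ?_
    rw [Real.norm_eq_abs, abs_le]
    exact ⟨by linarith [hβ0 ((0 : V3) + Real.sqrt (2 - ‖x‖) • w)], hβ1 _⟩
  · refine ae_of_all _ fun w => hβc.comp ?_
    exact continuous_const.add
      ((Real.continuous_sqrt.comp (continuous_const.sub continuous_norm)).smul continuous_const)

/-- **One-body velocity averages under the hot-spot local Gibbs law.** For a bounded continuous
`β ≥ 0` and every particle `i`, `E_λ β(vᵢ) = ∫_{𝕋³} (∫ β dN(0, (2 − ‖x‖) id)) dx`: the velocity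
fibre of particle `i` given the positions is `N(0, (2 − ‖xᵢ‖) id)` (disintegration
`lintegral_localGibbsMeasure`), and the one-particle position marginal of the homogeneous
configurational Gibbs measure is uniform (`integral_mul_shiftInvariant`). -/
private theorem lintegral_oneBody {σ a : ℝ} (hσ2 : σ ≤ 1 / 2) (ha : 0 < a) (N : ℕ)
    (Φ : HardSphereFlow (Torus.geometry (Fin 3)) (hsDiameter σ N) (N + 1)) (i : Fin (N + 1))
    {β : V3 → ℝ} (hβc : Continuous β) (hβ0 : ∀ v, 0 ≤ β v) (hβ1 : ∀ v, β v ≤ 1) :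
    ∫⁻ z, ENNReal.ofReal (β (z i).2)
        ∂(localGibbsLaw σ (fun _ => a) (fun _ => (0 : V3)) (fun x => 2 - ‖x‖) N Φ) =
      ENNReal.ofReal (∫ x : T3, ∫ v, β v ∂gaussMeasure (0 : V3) (2 - ‖x‖)) := by
  set G : T3 → ℝ := fun y => ∫ v, β v ∂gaussMeasure (0 : V3) (2 - ‖y‖) with hG
  have hGc : Continuous G := continuous_gaussAverage hβc hβ0 hβ1
  have hG0 : ∀ y, 0 ≤ G y := fun y => integral_nonneg hβ0
  have hG1 : ∀ y, G y ≤ 1 := fun y => by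
    have h := integral_mono (integrable_gauss hβc hβ0 hβ1 (0 : V3) (2 - ‖y‖))
      (integrable_const (1 : ℝ)) hβ1
    simpa using h
  have hθc : Continuous fun x : T3 => 2 - ‖x‖ := continuous_const.sub continuous_norm
  have hmeas : Measurable fun z : Config (N + 1) (Fin 3) T3 => ENNReal.ofReal (β (z i).2) :=
    (hβc.measurable.comp (measurable_pi_apply i).snd).ennreal_ofReal
  rw [localGibbsLaw_eq, lintegral_localGibbsMeasure (a₀ := fun _ => a) (θ₀ := fun x : T3 => 2 - ‖x‖)
    (u₀ := fun _ => (0 : V3)) continuous_const hθc continuous_const (fun _ => ha.le)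
    thetaHot_pos σ N hmeas,
    canonicalPartition_eq_posPartition (a₀ := fun _ => a) (θ₀ := fun x : T3 => 2 - ‖x‖)
    (u₀ := fun _ => (0 : V3)) continuous_const hθc continuous_const (fun _ => ha.le) thetaHot_pos]
  -- the velocity fibre of particle `i`
  have hinner : ∀ x : Fin (N + 1) → T3,
      ∫⁻ v, ENNReal.ofReal (β ((zipConfig (x, v) i).2))
          ∂velMeasure (fun _ => (0 : V3)) (fun x : T3 => 2 - ‖x‖) x = ENNReal.ofReal (G (x i)) := by
    intro x
    have hmp : MeasurePreserving (Function.eval i)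
        (velMeasure (fun _ => (0 : V3)) (fun x : T3 => 2 - ‖x‖) x)
        (gaussMeasure (0 : V3) (2 - ‖x i‖)) := by
      unfold velMeasure
      exact measurePreserving_eval _ i
    have h1 : ∫⁻ v, ENNReal.ofReal (β ((zipConfig (x, v) i).2))
          ∂velMeasure (fun _ => (0 : V3)) (fun x : T3 => 2 - ‖x‖) x =
        ∫⁻ w, ENNReal.ofReal (β w) ∂gaussMeasure (0 : V3) (2 - ‖x i‖) := by
      rw [← hmp.lintegral_comp hβc.measurable.ennreal_ofReal]
      rfl
    rw [h1, ← ofReal_integral_eq_lintegral_ofReal (integrable_gauss hβc hβ0 hβ1 _ _)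
      (ae_of_all _ hβ0)]
  simp_rw [hinner]
  -- the position marginal of particle `i` is uniform
  haveI := isProbabilityMeasure_posGibbsMeasure (a₀ := fun _ : T3 => a) continuous_const
    (fun _ => ha) hσ2 N
  have hdens : Measurable fun x : Fin (N + 1) → T3 => ENNReal.ofReal
      ((posPartition (fun _ : T3 => a) (hsDiameter σ N) (N + 1))⁻¹ *
        posWeight (fun _ : T3 => a) (hsDiameter σ N) (N + 1) x) :=
    ((measurable_posWeight continuous_const _ _).const_mul _).ennreal_ofReal
  have hGm : Measurable fun x : Fin (N + 1) → T3 => ENNReal.ofReal (G (x i)) :=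
    (hGc.measurable.comp (measurable_pi_apply i)).ennreal_ofReal
  have hP : ∫⁻ x, ENNReal.ofReal ((posPartition (fun _ : T3 => a) (hsDiameter σ N) (N + 1))⁻¹ *
        posWeight (fun _ : T3 => a) (hsDiameter σ N) (N + 1) x) * ENNReal.ofReal (G (x i)) =
      ∫⁻ x, ENNReal.ofReal (G (x i)) ∂posGibbsMeasure (fun _ : T3 => a) (hsDiameter σ N) (N + 1) := by
    rw [posGibbsMeasure, lintegral_withDensity_eq_lintegral_mul _ hdens hGm]
    rfl
  have hGi : Integrable (fun x : Fin (N + 1) → T3 => G (x i))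
      (posGibbsMeasure (fun _ : T3 => a) (hsDiameter σ N) (N + 1)) := by
    refine (integrable_const (1 : ℝ)).mono' (hGc.comp (continuous_apply i)).aestronglyMeasurable
      (ae_of_all _ fun x => ?_)
    rw [Real.norm_eq_abs, abs_le]
    exact ⟨by linarith [hG0 (x i)], hG1 _⟩
  have hshift := integral_mul_shiftInvariant a (hsDiameter σ N) i hGc (f := fun _ => (1 : ℝ))
    measurable_const (B := 1) (fun _ => by norm_num) (fun _ _ => rfl)
  simp only [mul_one, integral_const, probReal_univ, one_smul] at hshift
  rw [hP, ← ofReal_integral_eq_lintegral_ofReal hGi (ae_of_all _ fun x => hG0 (x i)), hshift]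

/-- **One-body velocity averages, summed over the particles**: under the hot-spot local Gibbs law,
for a bounded continuous `β ≥ 0`, `E_λ ∑ᵢ β(vᵢ) = (N+1) ∫_{𝕋³} (∫ β dN(0, (2 − ‖x‖) id)) dx`. -/
theorem rhsShortTime_lintegral_sum_oneBody {σ a : ℝ} (hσ2 : σ ≤ 1 / 2) (ha : 0 < a) (N : ℕ)
    (Φ : HardSphereFlow (Torus.geometry (Fin 3)) (hsDiameter σ N) (N + 1))
    {β : V3 → ℝ} (hβc : Continuous β) (hβ0 : ∀ v, 0 ≤ β v) (hβ1 : ∀ v, β v ≤ 1) :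
    ∫⁻ z, ∑ i, ENNReal.ofReal (β (z i).2)
        ∂(localGibbsLaw σ (fun _ => a) (fun _ => (0 : V3)) (fun x => 2 - ‖x‖) N Φ) =
      ENNReal.ofReal (((N + 1 : ℕ) : ℝ) * ∫ x : T3, ∫ v, β v ∂gaussMeasure (0 : V3) (2 - ‖x‖)) := by
  rw [lintegral_finsetSum Finset.univ
    (f := fun i (z : Config (N + 1) (Fin 3) T3) => ENNReal.ofReal (β (z i).2))
    fun i _ => (hβc.measurable.comp (measurable_pi_apply i).snd).ennreal_ofReal]
  simp_rw [lintegral_oneBody hσ2 ha N Φ _ hβc hβ0 hβ1]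
  rw [Finset.sum_const, Finset.card_univ, Fintype.card_fin, nsmul_eq_mul,
    ENNReal.ofReal_mul (Nat.cast_nonneg _), ENNReal.ofReal_natCast]

/-! ## Pathwise: velocities change only at collisions, and few particles collide -/

/-- **Pathwise count (registered helper `rhsShortTime_sum_flow_le` of stub D).** On a good orbit of a
hard-sphere flow on `𝕋³`, for `0 < τ ≤ h` and any `β ≤ 1`:
`∑ᵢ β(vᵢ(τ)) ≤ ∑ᵢ β(vᵢ(0)) + 2 · #(collision times in (0, h])` — a particle that takes part in no
collision during `(0, τ]` keeps its initial velocity (per-particle free stretch), and exactly two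
particles take part in each (binary) collision. -/
theorem rhsShortTime_sum_flow_le :
    ∀ (N : ℕ) (ε : ℝ) (Φ : HardSphereFlow (Torus.geometry (Fin 3)) ε (N + 1))
      (z : Config (N + 1) (Fin 3) T3), z ∈ Φ.good → ∀ (τ h : ℝ), 0 < τ → τ ≤ h →
      ∀ (β : V3 → ℝ), (∀ v, β v ≤ 1) →
        ∑ i : Fin (N + 1), ENNReal.ofReal (β (Φ.flow τ z i).2) ≤
          ∑ i : Fin (N + 1), ENNReal.ofReal (β (z i).2) +
            2 * ((collisionTimes (Torus.geometry (Fin 3)) ε (fun r => Φ.flow r z) ∩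
              Set.Ioc 0 h).ncard : ℝ≥0∞) := by
  intro N ε Φ z hz τ h hτ hτh β hβ1
  have htraj : IsHardSphereTrajectory (Torus.geometry (Fin 3)) ε (N + 1) fun r => Φ.flow r z :=
    Φ.isTrajectory z hz
  set T : Set ℝ := collisionTimes (Torus.geometry (Fin 3)) ε (fun r => Φ.flow r z) ∩ Set.Ioc 0 h
    with hT
  have hTfin : T.Finite := htraj.finite_collisionTimes_inter_of_subset_Icc Set.Ioc_subset_Icc_self
  -- the particles taking part in some collision during `(0, h]`
  set P : Finset (Fin (N + 1)) := Finset.univ.filter fun k =>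
    ∃ u ∈ T, Participates (Torus.geometry (Fin 3)) ε (Φ.flow u z) k with hP
  -- the other particles keep their initial velocity up to time `τ`
  have hvel : ∀ k, k ∉ P → (Φ.flow τ z k).2 = (z k).2 := by
    intro k hk
    have hfree : ∀ u ∈ Set.Ioc 0 τ,
        u ∉ collisionTimesOf (Torus.geometry (Fin 3)) ε (fun r => Φ.flow r z) k := by
      intro u hu huk
      exact hk (Finset.mem_filter.2 ⟨Finset.mem_univ _, u,
        ⟨collisionTimesOf_subset _ k huk, hu.1, hu.2.trans hτh⟩, huk⟩)
    have h : Φ.flow τ z k = freeFlight (Torus.geometry (Fin 3)) (τ - 0) (Φ.flow 0 z) k :=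
      RateFloorPerParticleFreeStretch.stub_perParticleFreeStretch (N + 1) ε (fun r => Φ.flow r z)
        htraj 0 τ k hτ.le hfree
    rw [h, Φ.flow_zero z hz, freeFlight_apply]
  -- termwise bound
  have hterm : ∀ k, ENNReal.ofReal (β (Φ.flow τ z k).2) ≤
      ENNReal.ofReal (β (z k).2) + if k ∈ P then 1 else 0 := by
    intro k
    by_cases hk : k ∈ P
    · rw [if_pos hk]
      calc ENNReal.ofReal (β (Φ.flow τ z k).2) ≤ ENNReal.ofReal 1 :=
            ENNReal.ofReal_le_ofReal (hβ1 _)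
        _ = 1 := ENNReal.ofReal_one
        _ ≤ _ := le_add_self
    · rw [if_neg hk, add_zero, hvel k hk]
  -- at most two participants per collision time
  have hcard : (P.card : ℝ≥0∞) ≤ 2 * (T.ncard : ℝ≥0∞) := by
    have hsub : P ⊆ hTfin.toFinset.biUnion fun u =>
        Finset.univ.filter fun k => Participates (Torus.geometry (Fin 3)) ε (Φ.flow u z) k := by
      intro k hk
      obtain ⟨u, huT, hku⟩ := (Finset.mem_filter.1 hk).2
      exact Finset.mem_biUnion.2 ⟨u, hTfin.mem_toFinset.2 huT,
        Finset.mem_filter.2 ⟨Finset.mem_univ _, hku⟩⟩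
    have htwo : ∀ u ∈ hTfin.toFinset, (Finset.univ.filter fun k =>
        Participates (Torus.geometry (Fin 3)) ε (Φ.flow u z) k).card ≤ 2 := by
      intro u hu
      have huT : u ∈ T := hTfin.mem_toFinset.1 hu
      obtain ⟨⟨p, q⟩, hpq⟩ := mem_collisionTimes_iff_contactPairs_nonempty.1 huT.1
      calc _ ≤ ({p, q} : Finset (Fin (N + 1))).card := by
            refine Finset.card_le_card fun k hk => ?_
            have hk' := (htraj.participates_iff hpq).1 (Finset.mem_filter.1 hk).2
            rcases hk' with rfl | rfl
            · exact Finset.mem_insert_self _ _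
            · exact Finset.mem_insert_of_mem (Finset.mem_singleton_self _)
        _ ≤ 2 := Finset.card_le_two
    have hnat : P.card ≤ 2 * T.ncard :=
      calc P.card ≤ (hTfin.toFinset.biUnion fun u => Finset.univ.filter fun k =>
              Participates (Torus.geometry (Fin 3)) ε (Φ.flow u z) k).card :=
            Finset.card_le_card hsub
        _ ≤ ∑ u ∈ hTfin.toFinset, (Finset.univ.filter fun k =>
              Participates (Torus.geometry (Fin 3)) ε (Φ.flow u z) k).card :=
            Finset.card_biUnion_le
        _ ≤ ∑ _u ∈ hTfin.toFinset, 2 := Finset.sum_le_sum htwo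
        _ = 2 * T.ncard := by
            rw [Finset.sum_const, smul_eq_mul, mul_comm, Set.ncard_eq_toFinset_card T hTfin]
    exact_mod_cast hnat
  calc ∑ i, ENNReal.ofReal (β (Φ.flow τ z i).2)
      ≤ ∑ i, (ENNReal.ofReal (β (z i).2) + if i ∈ P then 1 else 0) :=
        Finset.sum_le_sum fun i _ => hterm i
    _ = ∑ i, ENNReal.ofReal (β (z i).2) + (P.card : ℝ≥0∞) := by
        rw [Finset.sum_add_distrib, Finset.sum_boole, Finset.filter_mem_eq_inter, Finset.univ_inter]
    _ ≤ _ := add_le_add le_rfl hcard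

end Summit.AtomisticToContinuum.HydrodynamicLimit.Theorems.EnergyCurrentTailsRungHalf

end
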